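import Literature.MathematicalPhysics.QuantumManyBody.KernelNorm
import HarnessLib

/-!
# Tame products and power-tail finiteness for the graded many-body kernel norms

Topic `Literature/MathematicalPhysics/QuantumManyBody`; companion of `KernelNorm.lean` (definition
items `defn-KernelNorm` / `defn-KernelNorm-2`, posited by route BECNewtonPolicyIteration of
`Summits/AtomisticToContinuum/BoseEinsteinCondensation` for the informal crux `TameNewtonScheme`).
`KernelNorm.lean` defines the locality-graded, power-weighted norms
`kernelNorm L p z ℓ u = ∑_k z^k · sup_X treeWeight p ℓ L X · |u_k X|` of a family of many-body
kernels on the torus `ℝ³/Lℤ³`; this file PROVES the two elementary "required properties" of the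
definition request that are statements about the norms themselves.

* **(i) Tame product, algebraic core.** For configurations `X = (x₀,…,x_k)` and
  `Y = (y₀,…,y_{k'})` SHARING THE ROOT (`y₀ = x₀`), `rootMerge X Y = (x₀,…,x_k,y₁,…,y_{k'})` is
  the merged configuration of arity `k + k' + 1` ("products of `(k+1)`- and `(k'+1)`-body kernels
  sharing a particle are `(k+k'+1)`-body"), and
  `treeWeight (rootMerge X Y) ≤ treeWeight X * treeWeight Y` (`treeWeight_rootMerge_le`): in the
  merged configuration every particle has MORE predecessors than in `X` resp. `Y`, so its
  nearest-predecessor (insertion-tree) distance can only shrink (`treeDist_le_treeDist_of_pred`).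
  Consequently a kernel `h` of arity `k + k' + 1` dominated pointwise by
  `‖f(first k+1 particles)‖ · ‖g(root and last k' particles)‖` has
  `weightedSup h ≤ weightedSup f * weightedSup g` (`weightedSup_le_mul_of_norm_le`; the pointwise
  product `rootProd f g` of real kernels is the basic instance, `weightedSup_rootProd_le`), and with
  the activity bookkeeping `z^{k+k'} = z^k z^{k'}` each such product term is bounded by
  `kernelNorm u * kernelNorm u'` (`rootProd_term_le_kernelNorm_mul`). This is the continuum,
  multiplicative form of the lattice mechanism `w(X₁ Δ ⋯ Δ X_n) ≤ ∑_j w(X_j)` for subsets sharing a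
  site in the proof of [DattaKennedy2002, Thm. 1] (there `w` = size of the smallest connected set
  of bonds containing the subset and the weight is `θ^{-w}`).
* **(ii) Power tails have finite norm, uniformly in the volume.** If a pair kernel satisfies
  `‖f(x₀,x₁)‖ ≤ C (1 + d_L(x₁,x₀)/ℓ₀)^{-q}` and `p ≤ q`, then
  `weightedSup p ℓ L f ≤ C · max(1, ℓ₀/ℓ)^p < ∞` (`weightedSup_two_le_of_decay`), a bound that does
  not depend on `L`; for a family supported in arity two the whole norm is `z` times this
  (`kernelNorm_eq_of_pair`, `kernelNorm_pair_le_of_decay`, `gradKernelNorm_pair_le_of_decay`).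
  The cases `q = 2` and `q = 3` are the Reatto–Chester tail `u₂ ≍ r⁻²`, `∇u₂ ≍ r⁻³` of the
  two-body part of `-log Ψ₀` [ReattoChester1967]: finite norm for `p ≤ 2`, resp. `p ≤ 3`, whereas
  an `L¹`-in-one-variable norm of an `r⁻²` tail grows like `L`.

## What is NOT here

* The insertion tree is ORDER-DEPENDENT; bounding the weight of a re-rooted or re-ordered
  configuration by a constant (depending on `p` and the arity) times the weight in the given
  order — needed to symmetrise `rootProd f g` and to close the full estimate
  `‖presentation of |∇S|²‖ ≤ C ‖∇u‖²` of the route — is not proved here; nor is the merged bound for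
  kernels sharing MORE than one particle (the same monotonicity argument applies after dropping the
  duplicated particles' factors, which are `≥ 1`).
* Property (iii) of the request (one-particle oscillation moments of `S` under a Gibbs-type
  measure controlled by the norm for `p > 3/2`) is measure-theoretic route content.

## References

* [DattaKennedy2002] N. Datta, T. Kennedy, *Expansions for one quasiparticle states in spin 1/2
  systems*, J. Stat. Phys. 108 (2002) 373–399 (arXiv:cond-mat/0104199): §2, the norm
  `‖g‖ = ∑_{X ∋ i} |g(X)| |X| θ^{-w(X)}` and the claim `w(X₁ Δ ⋯ Δ X_n) ≤ ∑_j w(X_j)` in the proof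
  of Thm. 1.
* [ReattoChester1967] L. Reatto, G. V. Chester, *Phonons and the properties of a Bose system*,
  Phys. Rev. 155 (1967) 88–100.
-/

noncomputable section

open scoped ENNReal NNReal

namespace Literature.MathematicalPhysics.QuantumManyBody.BoseGas

/-! ### Tree distances shrink when the predecessor sets grow -/

section Compare

variable {k n : ℕ}

/-- If particle `J+1` of `Z` coincides with particle `j+1` of `X` and every predecessor
`x₀, …, x_j` of `x_{j+1}` occurs among the predecessors `z₀, …, z_J` of `z_{J+1}`, then the
insertion-tree distance of `z_{J+1}` in `Z` is at most that of `x_{j+1}` in `X` (an infimum over a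
larger set is smaller). [folklore] -/
theorem treeDist_le_treeDist_of_pred (L : ℝ) (Z : Config (n + 1)) (X : Config (k + 1))
    {J : Fin n} {j : Fin k} (hsucc : Z J.succ = X j.succ)
    (hpred : ∀ i ≤ j, ∃ I ≤ J, Z (Fin.castSucc I) = X (Fin.castSucc i)) :
    treeDist L Z J ≤ treeDist L X j := by
  refine Finset.le_inf' _ _ fun i hi => ?_
  obtain ⟨I, hI, hZ⟩ := hpred i (Finset.mem_Iic.1 hi)
  calc treeDist L Z J ≤ torusDist L (Z J.succ) (Z (Fin.castSucc I)) := treeDist_le L Z hI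
    _ = torusDist L (X j.succ) (X (Fin.castSucc i)) := by rw [hsucc, hZ]

/-- Under the hypotheses of `treeDist_le_treeDist_of_pred` the power-weight factor
`(1 + treeDist/ℓ)^p` of `z_{J+1}` in `Z` is at most that of `x_{j+1}` in `X` (`0 ≤ p`, `0 < ℓ`).
[folklore] -/
theorem treeWeight_factor_le_of_pred {p ℓ : ℝ} (hp : 0 ≤ p) (hℓ : 0 < ℓ) (L : ℝ)
    (Z : Config (n + 1)) (X : Config (k + 1)) {J : Fin n} {j : Fin k}
    (hsucc : Z J.succ = X j.succ)
    (hpred : ∀ i ≤ j, ∃ I ≤ J, Z (Fin.castSucc I) = X (Fin.castSucc i)) :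
    (1 + treeDist L Z J / ℓ) ^ p ≤ (1 + treeDist L X j / ℓ) ^ p :=
  Real.rpow_le_rpow (add_nonneg zero_le_one (div_nonneg (treeDist_nonneg L Z J) hℓ.le))
    (by
      have h := div_le_div_of_nonneg_right (treeDist_le_treeDist_of_pred L Z X hsucc hpred) hℓ.le
      linarith) hp

end Compare

/-! ### Merging two configurations at a common root -/

section RootMerge

variable {k k' : ℕ}

/-- The first `k + 1` particles `(z₀, …, z_k)` of a configuration of arity `k + k' + 1`.
[folklore] -/
def rootFst (Z : Config (k + k' + 1)) : Config (k + 1) :=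
  fun i => Z ⟨i, by have := i.isLt; omega⟩

/-- The root together with the last `k'` particles, `(z₀, z_{k+1}, …, z_{k+k'})`, of a
configuration of arity `k + k' + 1`. [folklore] -/
def rootSnd (Z : Config (k + k' + 1)) : Config (k' + 1) :=
  fun i => if (i : ℕ) = 0 then Z 0 else Z ⟨k + i, by have := i.isLt; omega⟩

/-- The ROOT MERGE `(x₀, …, x_k, y₁, …, y_{k'})` of `X = (x₀, …, x_k)` and `Y = (y₀, …, y_{k'})`:
the configuration of arity `k + k' + 1` carrying the product of a `(k+1)`-body and a
`(k'+1)`-body kernel that share the particle `x₀ = y₀` (the root of `Y` is dropped; intended for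
`Y 0 = X 0`). [folklore] -/
def rootMerge (X : Config (k + 1)) (Y : Config (k' + 1)) : Config (k + k' + 1) :=
  fun m => if h : (m : ℕ) ≤ k then X ⟨m, Nat.lt_succ_of_le h⟩
    else Y ⟨m - k, by have := m.isLt; omega⟩

/-- The first `k + 1` entries of the root merge are `X`. [folklore] -/
theorem rootMerge_apply_of_le (X : Config (k + 1)) (Y : Config (k' + 1)) (m : Fin (k + k' + 1))
    (h : (m : ℕ) ≤ k) : rootMerge X Y m = X ⟨m, Nat.lt_succ_of_le h⟩ :=
  dif_pos h

/-- The entries `k + 1, …, k + k'` of the root merge are `y₁, …, y_{k'}`. [folklore] -/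
theorem rootMerge_apply_of_lt (X : Config (k + 1)) (Y : Config (k' + 1)) (m : Fin (k + k' + 1))
    (h : k < (m : ℕ)) : rootMerge X Y m = Y ⟨m - k, by have := m.isLt; omega⟩ :=
  dif_neg (not_le.2 h)

/-- Entries of the root merge with index at most `k` are entries of `X`. [folklore] -/
theorem rootMerge_eq_fst (X : Config (k + 1)) (Y : Config (k' + 1)) (m : Fin (k + k' + 1))
    (i : Fin (k + 1)) (h : (m : ℕ) = i) : rootMerge X Y m = X i := by
  rw [rootMerge_apply_of_le X Y m (by have := i.isLt; omega)]
  congr 1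
  exact Fin.ext h

/-- Entries of the root merge with index `k + i`, `i ≥ 1`, are entries of `Y`. [folklore] -/
theorem rootMerge_eq_snd (X : Config (k + 1)) (Y : Config (k' + 1)) (m : Fin (k + k' + 1))
    (i : Fin (k' + 1)) (hi : (i : ℕ) ≠ 0) (h : (m : ℕ) = k + i) : rootMerge X Y m = Y i := by
  rw [rootMerge_apply_of_lt X Y m (by omega)]
  congr 1
  exact Fin.ext (by change (m : ℕ) - k = i; omega)

/-- The root of the merge is `x₀`. [folklore] -/
@[simp] theorem rootMerge_zero (X : Config (k + 1)) (Y : Config (k' + 1)) :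
    rootMerge X Y 0 = X 0 :=
  rootMerge_eq_fst X Y 0 0 (by simp)

/-- Particle `i + 1` of the merge is `x_{i+1}` for `i < k`. [folklore] -/
theorem rootMerge_succ_castAdd (X : Config (k + 1)) (Y : Config (k' + 1)) (i : Fin k) :
    rootMerge X Y (Fin.castAdd k' i).succ = X i.succ :=
  rootMerge_eq_fst X Y _ _ (by simp)

/-- Particle `i` of the merge is `x_i` for `i < k`. [folklore] -/
theorem rootMerge_castSucc_castAdd (X : Config (k + 1)) (Y : Config (k' + 1)) (i : Fin k) :
    rootMerge X Y (Fin.castSucc (Fin.castAdd k' i)) = X (Fin.castSucc i) :=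
  rootMerge_eq_fst X Y _ _ (by simp)

/-- Particle `k + i + 1` of the merge is `y_{i+1}` for `i < k'`. [folklore] -/
theorem rootMerge_succ_natAdd (X : Config (k + 1)) (Y : Config (k' + 1)) (i : Fin k') :
    rootMerge X Y (Fin.natAdd k i).succ = Y i.succ :=
  rootMerge_eq_snd X Y _ _ (by simp) (by
    have h1 : (((Fin.natAdd k i).succ : Fin (k + k' + 1)) : ℕ) = k + i + 1 := by simp
    have h2 : ((i.succ : Fin (k' + 1)) : ℕ) = i + 1 := by simp
    omega)

/-- Particle `k + i` of the merge is `y_i` for `1 ≤ i < k'`. [folklore] -/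
theorem rootMerge_castSucc_add (X : Config (k + 1)) (Y : Config (k' + 1)) (i : Fin k')
    (hi : (i : ℕ) ≠ 0) :
    rootMerge X Y (Fin.castSucc ⟨k + i, by have := i.isLt; omega⟩) = Y (Fin.castSucc i) :=
  rootMerge_eq_snd X Y _ _ (by simpa using hi) (by simp)

/-- Entries of `rootFst Z` are the entries of `Z` with the same index. [folklore] -/
theorem rootFst_apply (Z : Config (k + k' + 1)) (i : Fin (k + 1)) (m : Fin (k + k' + 1))
    (h : (i : ℕ) = m) : rootFst Z i = Z m := by
  simp only [rootFst]
  congr 1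
  exact Fin.ext h

/-- `rootFst Z` is rooted at `z₀`. [folklore] -/
@[simp] theorem rootFst_apply_zero (Z : Config (k + k' + 1)) : rootFst Z 0 = Z 0 :=
  rootFst_apply Z 0 0 (by simp)

/-- The root of `rootSnd Z` is `z₀`. [folklore] -/
@[simp] theorem rootSnd_apply_zero (Z : Config (k + k' + 1)) : rootSnd Z 0 = Z 0 := by
  simp [rootSnd]

/-- Entry `i ≥ 1` of `rootSnd Z` is `z_{k+i}`. [folklore] -/
theorem rootSnd_apply_of_ne_zero (Z : Config (k + k' + 1)) (i : Fin (k' + 1)) (hi : (i : ℕ) ≠ 0) :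
    rootSnd Z i = Z ⟨k + i, by have := i.isLt; omega⟩ :=
  if_neg hi

/-- Entry `i ≥ 1` of `rootSnd Z` is the entry of `Z` with index `k + i`. [folklore] -/
theorem rootSnd_apply_eq (Z : Config (k + k' + 1)) (i : Fin (k' + 1)) (m : Fin (k + k' + 1))
    (hi : (i : ℕ) ≠ 0) (h : (m : ℕ) = k + i) : rootSnd Z i = Z m := by
  rw [rootSnd_apply_of_ne_zero Z i hi]
  congr 1
  exact Fin.ext h.symm

/-- The two parts of a configuration share the root `z₀`. [folklore] -/
theorem rootSnd_zero (Z : Config (k + k' + 1)) : rootSnd Z 0 = rootFst Z 0 := by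
  rw [rootSnd_apply_zero, rootFst_apply_zero]

/-- `rootFst (rootMerge X Y) = X`. [folklore] -/
@[simp] theorem rootFst_rootMerge (X : Config (k + 1)) (Y : Config (k' + 1)) :
    rootFst (rootMerge X Y) = X := by
  funext i
  simp only [rootFst]
  exact rootMerge_eq_fst X Y _ i (by rfl)

/-- `rootSnd (rootMerge X Y) = Y` when `Y` is rooted at `x₀`. [folklore] -/
theorem rootSnd_rootMerge (X : Config (k + 1)) (Y : Config (k' + 1)) (h0 : Y 0 = X 0) :
    rootSnd (rootMerge X Y) = Y := by
  funext i
  by_cases hi : (i : ℕ) = 0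
  · have hi' : i = 0 := Fin.ext (by simpa using hi)
    subst hi'
    rw [rootSnd_apply_zero, rootMerge_zero, h0]
  · rw [rootSnd_apply_of_ne_zero _ i hi]
    exact rootMerge_eq_snd X Y _ i hi (by rfl)

/-- Every configuration of arity `k + k' + 1` is the root merge of its two parts. [folklore] -/
@[simp] theorem rootMerge_rootFst_rootSnd (Z : Config (k + k' + 1)) :
    rootMerge (rootFst Z) (rootSnd Z) = Z := by
  funext m
  by_cases h : (m : ℕ) ≤ k
  · rw [rootMerge_apply_of_le _ _ _ h]
    exact rootFst_apply Z _ m (by rfl)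
  · rw [rootMerge_apply_of_lt _ _ _ (not_le.1 h)]
    exact rootSnd_apply_eq Z _ m (by change (m : ℕ) - k ≠ 0; omega)
      (by change (m : ℕ) = k + ((m : ℕ) - k); omega)

/-- **Tame product, algebraic core.** Merging two configurations at a common root can only
decrease the tree weight below the product of the two weights:
`treeWeight (x₀,…,x_k,y₁,…,y_{k'}) ≤ treeWeight (x₀,…,x_k) · treeWeight (y₀,…,y_{k'})` for
`y₀ = x₀` (`0 ≤ p`, `0 < ℓ`) — every particle of the merge has at least the predecessors it had
in `X` resp. `Y`. Continuum, multiplicative analogue of `w(X₁ Δ X₂) ≤ w(X₁) + w(X₂)` for lattice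
subsets sharing a site (proof of Datta–Kennedy's Thm. 1). [folklore] -/
theorem treeWeight_rootMerge_le {p ℓ : ℝ} (hp : 0 ≤ p) (hℓ : 0 < ℓ) (L : ℝ) (X : Config (k + 1))
    (Y : Config (k' + 1)) (h0 : Y 0 = X 0) :
    treeWeight p ℓ L (rootMerge X Y) ≤ treeWeight p ℓ L X * treeWeight p ℓ L Y := by
  have hfac : ∀ {n : ℕ} (W : Config (n + 1)) (J : Fin n), 0 ≤ (1 + treeDist L W J / ℓ) ^ p :=
    fun W J => Real.rpow_nonneg (add_nonneg zero_le_one (div_nonneg (treeDist_nonneg L W J) hℓ.le)) _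
  unfold treeWeight
  rw [Fin.prod_univ_add]
  refine mul_le_mul (Finset.prod_le_prod (fun i _ => hfac _ _) fun i _ => ?_)
    (Finset.prod_le_prod (fun i _ => hfac _ _) fun i _ => ?_)
    (Finset.prod_nonneg fun i _ => hfac _ _) (Finset.prod_nonneg fun i _ => hfac _ _)
  · -- particles `x₁, …, x_k`: same predecessors as in `X`
    refine treeWeight_factor_le_of_pred hp hℓ L _ X (rootMerge_succ_castAdd X Y i) fun i₀ hi₀ => ?_
    refine ⟨Fin.castAdd k' i₀, ?_, rootMerge_castSucc_castAdd X Y i₀⟩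
    rw [Fin.le_iff_val_le_val, Fin.val_castAdd, Fin.val_castAdd]
    exact Fin.le_iff_val_le_val.1 hi₀
  · -- particles `y₁, …, y_{k'}`: the predecessors now include all of `X ∋ x₀ = y₀`
    refine treeWeight_factor_le_of_pred hp hℓ L _ Y (rootMerge_succ_natAdd X Y i) fun i₀ hi₀ => ?_
    by_cases hz : (i₀ : ℕ) = 0
    · refine ⟨⟨0, by have := i.pos; omega⟩, Fin.le_iff_val_le_val.2 (Nat.zero_le _), ?_⟩
      have h1 : Fin.castSucc i₀ = 0 := Fin.ext (by simpa using hz)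
      rw [h1, h0]
      exact rootMerge_eq_fst X Y _ 0 (by simp)
    · refine ⟨⟨k + i₀, by have := i₀.isLt; omega⟩, ?_, rootMerge_castSucc_add X Y i₀ hz⟩
      rw [Fin.le_iff_val_le_val, Fin.val_natAdd]
      exact Nat.add_le_add_left (Fin.le_iff_val_le_val.1 hi₀) k

end RootMerge

/-! ### Tame product of weighted sup norms -/

section Product

variable {k k' : ℕ} {E F G : Type*} [SeminormedAddCommGroup E] [SeminormedAddCommGroup F]
  [SeminormedAddCommGroup G]

/-- **Tame product of weighted sup norms.** If a kernel `h` of arity `k + k' + 1` is dominated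
pointwise by `‖f(z₀,…,z_k)‖ · ‖g(z₀,z_{k+1},…,z_{k+k'})‖`, then
`weightedSup h ≤ weightedSup f · weightedSup g` (`0 ≤ p`, `0 < ℓ`; all in `[0, ∞]`). Covers
products of real kernels and, via Cauchy–Schwarz, inner products of gradient kernels sharing a
particle. [folklore] -/
theorem weightedSup_le_mul_of_norm_le {p ℓ : ℝ} (hp : 0 ≤ p) (hℓ : 0 < ℓ) (L : ℝ)
    (f : Config (k + 1) → E) (g : Config (k' + 1) → F) (h : Config (k + k' + 1) → G)
    (hdom : ∀ Z, ‖h Z‖ ≤ ‖f (rootFst Z)‖ * ‖g (rootSnd Z)‖) :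
    weightedSup p ℓ L h ≤ weightedSup p ℓ L f * weightedSup p ℓ L g := by
  refine weightedSup_le fun Z => ?_
  have hw : treeWeight p ℓ L Z ≤ treeWeight p ℓ L (rootFst Z) * treeWeight p ℓ L (rootSnd Z) := by
    have := treeWeight_rootMerge_le hp hℓ L (rootFst Z) (rootSnd Z) (rootSnd_zero Z)
    rwa [rootMerge_rootFst_rootSnd] at this
  have h1 : ‖h Z‖₊ ≤ ‖f (rootFst Z)‖₊ * ‖g (rootSnd Z)‖₊ :=
    NNReal.coe_le_coe.1 (by simpa using hdom Z)
  have h2 : (‖h Z‖₊ : ℝ≥0∞) ≤ (‖f (rootFst Z)‖₊ : ℝ≥0∞) * ‖g (rootSnd Z)‖₊ := by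
    exact_mod_cast h1
  calc ENNReal.ofReal (treeWeight p ℓ L Z) * ‖h Z‖₊
      ≤ ENNReal.ofReal (treeWeight p ℓ L (rootFst Z) * treeWeight p ℓ L (rootSnd Z)) *
          ((‖f (rootFst Z)‖₊ : ℝ≥0∞) * ‖g (rootSnd Z)‖₊) :=
        mul_le_mul' (ENNReal.ofReal_le_ofReal hw) h2
    _ = ENNReal.ofReal (treeWeight p ℓ L (rootFst Z)) * ‖f (rootFst Z)‖₊ *
          (ENNReal.ofReal (treeWeight p ℓ L (rootSnd Z)) * ‖g (rootSnd Z)‖₊) := by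
        rw [ENNReal.ofReal_mul (treeWeight_nonneg p hℓ L _)]
        ring
    _ ≤ weightedSup p ℓ L f * weightedSup p ℓ L g :=
        mul_le_mul' (weighted_le_weightedSup p ℓ L f _) (weighted_le_weightedSup p ℓ L g _)

/-- The ROOT PRODUCT `(f ⋆ g)(z₀,…,z_{k+k'}) = f(z₀,…,z_k) · g(z₀,z_{k+1},…,z_{k+k'})` of two real
kernels sharing the root particle: a kernel of arity `k + k' + 1`. [folklore] -/
def rootProd (f : Config (k + 1) → ℝ) (g : Config (k' + 1) → ℝ) : Config (k + k' + 1) → ℝ :=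
  fun Z => f (rootFst Z) * g (rootSnd Z)

/-- On a root merge the root product is the product of the values (`Y 0 = X 0`). [folklore] -/
theorem rootProd_rootMerge (f : Config (k + 1) → ℝ) (g : Config (k' + 1) → ℝ) (X : Config (k + 1))
    (Y : Config (k' + 1)) (h0 : Y 0 = X 0) : rootProd f g (rootMerge X Y) = f X * g Y := by
  simp only [rootProd, rootFst_rootMerge, rootSnd_rootMerge X Y h0]

/-- **Tame product** for real kernels: `weightedSup (f ⋆ g) ≤ weightedSup f · weightedSup g`
(`0 ≤ p`, `0 < ℓ`). [folklore] -/
theorem weightedSup_rootProd_le {p ℓ : ℝ} (hp : 0 ≤ p) (hℓ : 0 < ℓ) (L : ℝ)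
    (f : Config (k + 1) → ℝ) (g : Config (k' + 1) → ℝ) :
    weightedSup p ℓ L (rootProd f g) ≤ weightedSup p ℓ L f * weightedSup p ℓ L g :=
  weightedSup_le_mul_of_norm_le hp hℓ L f g _ fun _ => norm_mul_le _ _

/-- Activity bookkeeping of the tame product: the merged kernel has arity `k + k' + 1`, hence
activity weight `z^{k+k'} = z^k · z^{k'}`, so
`z^{k+k'} weightedSup (f ⋆ g) ≤ (z^k weightedSup f) · (z^{k'} weightedSup g)`. [folklore] -/
theorem activity_mul_weightedSup_rootProd_le {p ℓ : ℝ} (hp : 0 ≤ p) (hℓ : 0 < ℓ) (L : ℝ)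
    (z : ℝ≥0) (f : Config (k + 1) → ℝ) (g : Config (k' + 1) → ℝ) :
    (z : ℝ≥0∞) ^ (k + k') * weightedSup p ℓ L (rootProd f g) ≤
      (z : ℝ≥0∞) ^ k * weightedSup p ℓ L f * ((z : ℝ≥0∞) ^ k' * weightedSup p ℓ L g) := by
  rw [pow_add, mul_mul_mul_comm]
  exact mul_le_mul' le_rfl (weightedSup_rootProd_le hp hℓ L f g)

/-- Each root-product term of two kernel families is bounded by the product of their graded
norms: `z^{k+k'} weightedSup (u_k ⋆ u'_{k'}) ≤ ‖u‖_{p,z,ℓ} · ‖u'‖_{p,z,ℓ}` (`0 ≤ p`, `0 < ℓ`).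
[folklore] -/
theorem rootProd_term_le_kernelNorm_mul {p ℓ : ℝ} (hp : 0 ≤ p) (hℓ : 0 < ℓ) (L : ℝ) (z : ℝ≥0)
    (u u' : (k : ℕ) → Config (k + 1) → ℝ) (k k' : ℕ) :
    (z : ℝ≥0∞) ^ (k + k') * weightedSup p ℓ L (rootProd (u k) (u' k')) ≤
      kernelNorm L p z ℓ u * kernelNorm L p z ℓ u' :=
  (activity_mul_weightedSup_rootProd_le hp hℓ L z (u k) (u' k')).trans
    (mul_le_mul' (weightedSup_le_kernelNorm L p z ℓ u k) (weightedSup_le_kernelNorm L p z ℓ u' k'))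

end Product

/-! ### Power tails have finite norm -/

section Decay

variable {E : Type*} [SeminormedAddCommGroup E]

/-- **Power tails have finite weighted sup norm, uniformly in `L`.** If a pair kernel decays like
`‖f(x₀, x₁)‖ ≤ C (1 + d_L(x₁, x₀)/ℓ₀)^{-q}` with `p ≤ q` (`0 ≤ p`, `0 < ℓ, ℓ₀`, `0 ≤ C`), then
`weightedSup p ℓ L f ≤ C · max(1, ℓ₀/ℓ)^p`. With `q = 2` (the Reatto–Chester tail `u₂ ≍ r⁻²`)
the norm is finite for every `p ≤ 2`, with `q = 3` (`∇u₂ ≍ r⁻³`) for every `p ≤ 3`. [folklore] -/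
theorem weightedSup_two_le_of_decay {p q ℓ ℓ₀ C : ℝ} (hp : 0 ≤ p) (hpq : p ≤ q) (hℓ : 0 < ℓ)
    (hℓ₀ : 0 < ℓ₀) (hC : 0 ≤ C) (L : ℝ) (f : Config (1 + 1) → E)
    (hf : ∀ X, ‖f X‖ ≤ C * (1 + torusDist L (X 1) (X 0) / ℓ₀) ^ (-q)) :
    weightedSup p ℓ L f ≤ ENNReal.ofReal (C * max 1 (ℓ₀ / ℓ) ^ p) := by
  refine weightedSup_le fun X => ?_
  have hfX := hf X
  have hd : 0 ≤ torusDist L (X 1) (X 0) := torusDist_nonneg L _ _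
  rw [treeWeight_two]
  generalize torusDist L (X 1) (X 0) = d at hfX hd ⊢
  have hM1 : (1 : ℝ) ≤ max 1 (ℓ₀ / ℓ) := le_max_left _ _
  have hM2 : ℓ₀ / ℓ ≤ max 1 (ℓ₀ / ℓ) := le_max_right _ _
  have hb : 0 ≤ 1 + d / ℓ := add_nonneg zero_le_one (div_nonneg hd hℓ.le)
  have hb₀ : 1 ≤ 1 + d / ℓ₀ := le_add_of_nonneg_right (div_nonneg hd hℓ₀.le)
  have hb₀pos : 0 < 1 + d / ℓ₀ := one_pos.trans_le hb₀
  have hkey : 1 + d / ℓ ≤ max 1 (ℓ₀ / ℓ) * (1 + d / ℓ₀) := by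
    have hdiv : d / ℓ = ℓ₀ / ℓ * (d / ℓ₀) := by
      field_simp
    rw [mul_add, mul_one, hdiv]
    exact add_le_add hM1 (mul_le_mul_of_nonneg_right hM2 (div_nonneg hd hℓ₀.le))
  have step1 : (1 + d / ℓ) ^ p ≤ max 1 (ℓ₀ / ℓ) ^ p * (1 + d / ℓ₀) ^ p := by
    rw [← Real.mul_rpow (zero_le_one.trans hM1) hb₀pos.le]
    exact Real.rpow_le_rpow hb hkey hp
  have step2 : (1 + d / ℓ₀) ^ p * (1 + d / ℓ₀) ^ (-q) ≤ 1 := by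
    rw [← Real.rpow_add hb₀pos]
    exact Real.rpow_le_one_of_one_le_of_nonpos hb₀ (by linarith)
  have hfin : (1 + d / ℓ) ^ p * ‖f X‖ ≤ C * max 1 (ℓ₀ / ℓ) ^ p := by
    calc (1 + d / ℓ) ^ p * ‖f X‖
        ≤ max 1 (ℓ₀ / ℓ) ^ p * (1 + d / ℓ₀) ^ p * (C * (1 + d / ℓ₀) ^ (-q)) :=
          mul_le_mul step1 hfX (norm_nonneg _) (by positivity)
      _ = C * max 1 (ℓ₀ / ℓ) ^ p * ((1 + d / ℓ₀) ^ p * (1 + d / ℓ₀) ^ (-q)) := by ring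
      _ ≤ C * max 1 (ℓ₀ / ℓ) ^ p * 1 := mul_le_mul_of_nonneg_left step2 (by positivity)
      _ = C * max 1 (ℓ₀ / ℓ) ^ p := mul_one _
  calc ENNReal.ofReal ((1 + d / ℓ) ^ p) * (‖f X‖₊ : ℝ≥0∞)
      = ENNReal.ofReal ((1 + d / ℓ) ^ p * ‖f X‖) := by
        rw [ENNReal.ofReal_mul (Real.rpow_nonneg hb p), ofReal_norm, enorm_eq_nnnorm]
    _ ≤ ENNReal.ofReal (C * max 1 (ℓ₀ / ℓ) ^ p) := ENNReal.ofReal_le_ofReal hfin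

/-- In particular a power-tail pair kernel has FINITE weighted sup norm (hypotheses of
`weightedSup_two_le_of_decay`). [folklore] -/
theorem weightedSup_two_lt_top_of_decay {p q ℓ ℓ₀ C : ℝ} (hp : 0 ≤ p) (hpq : p ≤ q) (hℓ : 0 < ℓ)
    (hℓ₀ : 0 < ℓ₀) (hC : 0 ≤ C) (L : ℝ) (f : Config (1 + 1) → E)
    (hf : ∀ X, ‖f X‖ ≤ C * (1 + torusDist L (X 1) (X 0) / ℓ₀) ^ (-q)) :
    weightedSup p ℓ L f < ∞ :=
  (weightedSup_two_le_of_decay hp hpq hℓ hℓ₀ hC L f hf).trans_lt ENNReal.ofReal_lt_top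

end Decay

/-! ### Families supported in arity two -/

section Pair

variable {E : ℕ → Type*} [∀ k, SeminormedAddCommGroup (E k)]

/-- For a family supported in arity two (`u k = 0` unless `k = 1`) the graded norm is
`z · weightedSup (u 1)`. [folklore] -/
theorem kernelNorm_eq_of_pair (L p : ℝ) (z : ℝ≥0) (ℓ : ℝ) (u : (k : ℕ) → Config (k + 1) → E k)
    (hu : ∀ k, k ≠ 1 → u k = 0) : kernelNorm L p z ℓ u = z * weightedSup p ℓ L (u 1) := by
  unfold kernelNorm
  rw [tsum_eq_single 1]
  · rw [pow_one]
  · intro k hk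
    rw [hu k hk, weightedSup_zero, mul_zero]

/-- **(ii) of the definition request.** A pair family whose kernel has a power tail
`‖u₁(x₀,x₁)‖ ≤ C (1 + d_L(x₁,x₀)/ℓ₀)^{-q}`, `p ≤ q`, has graded norm
`≤ z · C · max(1, ℓ₀/ℓ)^p`, a bound independent of the side `L` of the torus. [folklore] -/
theorem kernelNorm_pair_le_of_decay {p q ℓ ℓ₀ C : ℝ} (hp : 0 ≤ p) (hpq : p ≤ q) (hℓ : 0 < ℓ)
    (hℓ₀ : 0 < ℓ₀) (hC : 0 ≤ C) (L : ℝ) (z : ℝ≥0) (u : (k : ℕ) → Config (k + 1) → E k)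
    (hu : ∀ k, k ≠ 1 → u k = 0)
    (hf : ∀ X, ‖u 1 X‖ ≤ C * (1 + torusDist L (X 1) (X 0) / ℓ₀) ^ (-q)) :
    kernelNorm L p z ℓ u ≤ z * ENNReal.ofReal (C * max 1 (ℓ₀ / ℓ) ^ p) := by
  rw [kernelNorm_eq_of_pair L p z ℓ u hu]
  exact mul_le_mul' le_rfl (weightedSup_two_le_of_decay hp hpq hℓ hℓ₀ hC L (u 1) hf)

/-- Hence such a pair family has FINITE graded norm. [folklore] -/
theorem kernelNorm_pair_lt_top_of_decay {p q ℓ ℓ₀ C : ℝ} (hp : 0 ≤ p) (hpq : p ≤ q) (hℓ : 0 < ℓ)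
    (hℓ₀ : 0 < ℓ₀) (hC : 0 ≤ C) (L : ℝ) (z : ℝ≥0) (u : (k : ℕ) → Config (k + 1) → E k)
    (hu : ∀ k, k ≠ 1 → u k = 0)
    (hf : ∀ X, ‖u 1 X‖ ≤ C * (1 + torusDist L (X 1) (X 0) / ℓ₀) ^ (-q)) :
    kernelNorm L p z ℓ u < ∞ :=
  (kernelNorm_pair_le_of_decay hp hpq hℓ hℓ₀ hC L z u hu hf).trans_lt
    (ENNReal.mul_lt_top ENNReal.coe_lt_top ENNReal.ofReal_lt_top)

end Pair

/-- **(ii) for the gradient norm.** A real pair family (`u k = 0` unless `k = 1`) whose pair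
kernel has a power-tail DERIVATIVE, `‖D(u₁)(x₀,x₁)‖ ≤ C (1 + d_L(x₁,x₀)/ℓ₀)^{-q}` with `p ≤ q`
(Reatto–Chester: `q = 3`), has gradient norm `≤ z · C · max(1, ℓ₀/ℓ)^p < ∞`, independently of
`L`. [folklore] -/
theorem gradKernelNorm_pair_le_of_decay {p q ℓ ℓ₀ C : ℝ} (hp : 0 ≤ p) (hpq : p ≤ q) (hℓ : 0 < ℓ)
    (hℓ₀ : 0 < ℓ₀) (hC : 0 ≤ C) (L : ℝ) (z : ℝ≥0) (u : (k : ℕ) → Config (k + 1) → ℝ)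
    (hu : ∀ k, k ≠ 1 → u k = 0)
    (hf : ∀ X, ‖fderiv ℝ (u 1) X‖ ≤ C * (1 + torusDist L (X 1) (X 0) / ℓ₀) ^ (-q)) :
    gradKernelNorm L p z ℓ u ≤ z * ENNReal.ofReal (C * max 1 (ℓ₀ / ℓ) ^ p) := by
  unfold gradKernelNorm
  refine kernelNorm_pair_le_of_decay hp hpq hℓ hℓ₀ hC L z (fun k X => fderiv ℝ (u k) X)
    (fun k hk => ?_) hf
  funext X
  rw [hu k hk, fderiv_zero]

end Literature.MathematicalPhysics.QuantumManyBody.BoseGas
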